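import Mathlib

/-!
# SoloBlind — band-edge regularity and the second-order (K3′) weights (kernel #133)

Paper §24.87 (the tabulation of (P⁺)/(K3)/(N5), kit jobs j327667/j327703).  Around the composite
steady state the pattern-scale linearisation in the standing-pattern class `X^sym_n` is a
Kolmogorov-profile Orr–Sommerfeld problem at `Re_p → ∞`; the tabulation found no stationary
eigenvalue crossing in any sector (all onsets are Hopf), and the only neutral points with zero
phase speed relative to `U_s` are BAND EDGES `k² = K - λ₁`, where the neutral function is the class
ground state.  Elementary facts recorded here:

* `rayleigh_bracket_constK`, `band_edge_mode`: for `-U'' = K (U - U_s)` and a class ground state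
  `w₁` with `(D² - k²) w₁ = -K w₁` (i.e. `k² = K - λ₁`), the viscous Orr–Sommerfeld equation on `w₁`
  collapses to the scalar equation `i k K (c - U_s) = ν K²`, solved EXACTLY by
  `c = U_s - i ν K / k`: the edge mode travels at the inflection velocity and is damped at rate
  `ν K` (`= K₀` for the primary, `4 K₀` for the slaved second harmonic) — never a steady kernel.
* `second_harmonic_band`: lemma (P) for the transverse second harmonic (`K = 4`, class ground
  state `sin z`, `λ₁ = 1`): the no-mode criterion fails exactly on `k² ≤ 3` (the subharmonic band
  found Hopf-unstable at `Re₂ ≳ 20` in j327703).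
* `k3_first_order_vanishes`, `k3_diag_weight`, `k3_offdiag_weight`, `k3_second_order_coefficient`:
  the integrals and arithmetic of the second-order law `λ₁ = 16 ε₃ - 24 ε₂² + O(ε³)` for the
  distorted profile `cos z + ε₂ cos 2z + ε₃ cos 3z` (`K - 1 = 6ε₂ cos z - 6ε₂²(cos 2z - 3) + …`;
  first order vanishes, diagonal second order `-21 ε₂²`, off-diagonal via `sin 2z` (gap 3) `-3 ε₂²`),
  confirmed numerically to 0.5 % in j327667.
* `orders_needed_gamma_one`: with loss exponent `γ = 1` the order count `(N₀+1)/3 > 2γ` of the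
  closing scheme (E_{N₀}) gives `N₀ = 6` and not `5`.
-/

namespace Summit.AnomalousDissipation.AnomalousDissipation.Theorems

open Real intervalIntegral Complex

/-- The Rayleigh bracket `(U - c)(D² - k²)w - U'' w` evaluated on a function with
`(D² - k²) w = -K w` for a constant-`K` profile `-U'' = K (U - U_s)`: the profile value `U`
drops out and only `K (c - U_s)` remains. -/
theorem rayleigh_bracket_constK (U c K Us : ℂ) :
    (U - c) * (-K) + K * (U - Us) = K * (c - Us) := by
  ring

/-- **Band-edge regularity.**  The scalar Orr–Sommerfeld equation at a band edge,
`i k · K (c - U_s) = ν K²`, is solved exactly by `c = U_s - i ν K / k`, and the temporal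
eigenvalue `-i k c` then has real part `-ν K < 0`: the edge mode is a travelling, strictly
damped exact eigenfunction, so it never produces a kernel of the steady operator. -/
theorem band_edge_mode (K ν k Us : ℝ) (hk : k ≠ 0) (hK : 0 < K) (hν : 0 < ν) :
    I * k * (K * (((Us : ℂ) - I * ν * K / k) - Us)) = ν * K ^ 2
    ∧ (-(I * k * ((Us : ℂ) - I * ν * K / k))).re = -(ν * K)
    ∧ (-(I * k * ((Us : ℂ) - I * ν * K / k))).re < 0 := by
  have hk' : (k : ℂ) ≠ 0 := by exact_mod_cast hk
  have h1 : I * k * (K * (((Us : ℂ) - I * ν * K / k) - Us)) = ν * K ^ 2 := by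
    have e : I * k * (K * (((Us : ℂ) - I * ν * K / k) - Us))
        = -(I * I) * ν * K ^ 2 * ((k : ℂ) * (k : ℂ)⁻¹) := by ring
    rw [e, mul_inv_cancel₀ hk', Complex.I_mul_I]; ring
  have h2 : -(I * k * ((Us : ℂ) - I * ν * K / k))
      = ((-(ν * K) : ℝ) : ℂ) + ((-(k * Us) : ℝ) : ℂ) * I := by
    have e : -(I * k * ((Us : ℂ) - I * ν * K / k))
        = -(I * k * Us) + (I * I) * ν * K * ((k : ℂ) * (k : ℂ)⁻¹) := by ring
    rw [e, mul_inv_cancel₀ hk', Complex.I_mul_I]; push_cast; ring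
  have hre : (-(I * k * ((Us : ℂ) - I * ν * K / k))).re = -(ν * K) := by
    rw [h2]; simp
  refine ⟨h1, hre, ?_⟩
  rw [hre]; linarith [mul_pos hν hK]

/-- Lemma (P) for the transverse SECOND harmonic `cos 2z` seen in the standing-pattern class:
`K = 4`, and the class contains the subharmonic `sin z`, so `λ₁ = 1`; the no-mode criterion
`K < λ₁ + k²` fails exactly on the band `k² ≤ 3`. -/
theorem second_harmonic_band {k2 : ℝ} : ¬ ((4 : ℝ) < 1 + k2) ↔ k2 ≤ 3 := by
  rw [not_lt]; constructor <;> intro h <;> linarith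

/-- (K3′) first order: the weight `∫₀^π sin²z cos z dz` of the `6 ε₂ cos z` term vanishes. -/
theorem k3_first_order_vanishes :
    ∫ x in (0:ℝ)..π, Real.sin x ^ 2 * Real.cos x = 0 := by
  have h : ∫ x in (0:ℝ)..π, Real.sin x ^ 2 * Real.cos x ^ (2 * 0 + 1)
      = ∫ u in Real.sin 0..Real.sin π, u ^ 2 * (1 - u ^ 2) ^ 0 :=
    integral_sin_pow_mul_cos_pow_odd 2 0
  simp only [mul_zero, zero_add, pow_one, pow_zero, mul_one, Real.sin_zero, Real.sin_pi,
    intervalIntegral.integral_same] at h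
  exact h

/-- (K3′) diagonal second order: `∫₀^π (3 - cos 2z) sin²z dz = 7π/4`
(so `-⟨K₂⟩ = -(2/π)·6·(7π/4)·ε₂² = -21 ε₂²`). -/
theorem k3_diag_weight :
    ∫ x in (0:ℝ)..π, (3 - Real.cos (2 * x)) * Real.sin x ^ 2 = 7 * π / 4 := by
  have h1 : ∀ x : ℝ, (3 - Real.cos (2 * x)) * Real.sin x ^ 2
      = 4 * Real.sin x ^ 2 - 2 * (Real.sin x ^ 2 * Real.cos x ^ 2) := fun x => by
    rw [Real.cos_two_mul]; ring
  simp_rw [h1]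
  have hs4 : Real.sin (4 * π) = 0 := by
    have := Real.sin_nat_mul_pi 4
    push_cast at this
    exact this
  rw [intervalIntegral.integral_sub, intervalIntegral.integral_const_mul,
    intervalIntegral.integral_const_mul, integral_sin_sq, integral_sin_sq_mul_cos_sq]
  · simp only [sub_zero, mul_zero, Real.sin_zero, Real.cos_zero, Real.sin_pi, hs4, zero_mul,
      sub_self, zero_div, mul_one, Real.cos_pi]
    ring
  · exact ((continuous_const.mul (Real.continuous_sin.pow 2)).intervalIntegrable _ _)
  · exact ((continuous_const.mul
      ((Real.continuous_sin.pow 2).mul (Real.continuous_cos.pow 2))).intervalIntegrable _ _)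

/-- (K3′) off-diagonal second order: `∫₀^π cos z sin z sin 2z dz = π/4`, so
`⟨sin 2z| 6ε₂ cos z |sin z⟩ = (2/π)·6·(π/4)·ε₂ = 3 ε₂` and the level-repulsion term is
`-(3ε₂)²/3 = -3 ε₂²` (gap `λ₂ - λ₁ = 3`). -/
theorem k3_offdiag_weight :
    ∫ x in (0:ℝ)..π, Real.cos x * Real.sin x * Real.sin (2 * x) = π / 4 := by
  have h1 : ∀ x : ℝ, Real.cos x * Real.sin x * Real.sin (2 * x)
      = 2 * (Real.sin x ^ 2 * Real.cos x ^ 2) := fun x => by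
    rw [Real.sin_two_mul]; ring
  simp_rw [h1]
  have hs4 : Real.sin (4 * π) = 0 := by
    have := Real.sin_nat_mul_pi 4
    push_cast at this
    exact this
  rw [intervalIntegral.integral_const_mul, integral_sin_sq_mul_cos_sq]
  simp only [sub_zero, mul_zero, Real.sin_zero, hs4, sub_self, zero_div]
  ring

/-- (K3′) the coefficient: `-21 - 3 = -24`, i.e. `λ₁ = 16 ε₃ - 24 ε₂² + O(ε³)`. -/
theorem k3_second_order_coefficient :
    -(2 / π) * (6 * (7 * π / 4)) - ((2 / π) * 6 * (π / 4)) ^ 2 / 3 = (-24 : ℝ) := by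
  have hπ : (π : ℝ) ≠ 0 := Real.pi_ne_zero
  field_simp
  ring

/-- Order count of the closing scheme (E_{N₀}) at loss exponent `γ = 1`:
`(N₀ + 1)/3 > 2γ` holds for `N₀ = 6` and fails for `N₀ = 5`. -/
theorem orders_needed_gamma_one :
    ((6 : ℝ) + 1) / 3 > 2 * 1 ∧ ¬ (((5 : ℝ) + 1) / 3 > 2 * 1) := by
  constructor <;> norm_num

end Summit.AnomalousDissipation.AnomalousDissipation.Theorems
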